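import Summits.CriticalPhenomena.PercolationContinuityZ3.Theorems.PercNearOneGluingNoHeavyQuantBlockCombMergeModel
import HarnessLib

/-!
# QUANT lane R8, FAR on trees: the BLOCK-STAR ROW under the mean hypothesis, in the canonical block-comb vocabulary

builds on p205010 (kernel theorem, internal audit signed; external expert review pending)

Support file (`--supports stmt-CriticalPhenomena-4575`), QUANT lane lead (gen 13); memo
`run/shared/lean/prim/quant/prim-quant-lead-g13/LEAD-NOTES-G13.md` N24 (6).  Theorems only (local notation, no definitions),
no sorries, standard axioms.  Model and notation: `…QuantBlockCombMergeModel.lean`.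

* `Quant.BlockComb.tail_one_ge_rootGate_of_mean` — **the canonical `D = 1` bridge to `Quant.IndepBlob.far_indepBlob`.**  One chain gate
  `q 0`, blobs at level `0` with private gates `g k ≥ q 0`, blobs at level `1` all SURE (`g k = 1`: one glued terminal block behind the
  chain gate), and the MEAN hypothesis `2j < Σ_{lv k = 0} a k·g k + q 0·Σ_{lv k ≠ 0} a k`; then `q 0 ≤ TAIL[1, q, lv, a, g, j]`, i.e.
  `P(N ≥ j+1) ≥` the least marginal.  This is FAR for independent blobs (lead g5, p216624) — the observer joined by independent gates to
  glued blocks, the terminal block behind the least reliable gate — read in the canonical block-comb model: the configuration sum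
  over `S ⊆ κ` at depth `0`/`1` is `1 −` the light mass of `far_indepBlob` (a set `S` missing a sure level-`1` blob has weight `0`, so at
  depth `1` the level-`1` mass is the whole terminal block).  USE (LEAD-NOTES-G13 N24 (2)(i), file `…QuantBlockCombRootContraction`):
  after ROOT CONTRACTION a two-plateau block-comb whose root blocks are MORE reliable than the deep private gate becomes exactly such a
  `D = 1` instance, and this row closes it.
-/

namespace Summit.CriticalPhenomena.PercolationContinuityZ3.Theorems

namespace Quant

namespace BlockComb

open Finset

variable {κ : Type*} [Fintype κ] [DecidableEq κ]

/-- product-Bernoulli weight of the set `S` of open blob gates -/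
local notation3 "wt[" g ", " S "]" => ∏ k, (if k ∈ (S : Finset κ) then (g : κ → ℝ) k else 1 - (g : κ → ℝ) k)

/-- probability that the chain `q` of length `D` is open exactly to depth `i` -/
local notation3 "pd[" D ", " q ", " i "]" =>
  (∏ i' ∈ Finset.range (i : ℕ), (q : ℕ → ℝ) i') * (if (i : ℕ) < (D : ℕ) then 1 - (q : ℕ → ℝ) i else 1)

/-- mass counted at depth `i` in blob configuration `S` -/
local notation3 "mass[" lv ", " a ", " i ", " S "]" =>
  ∑ k ∈ (S : Finset κ).filter (fun k => (lv : κ → ℕ) k ≤ (i : ℕ)), ((a : κ → ℕ) k : ℕ)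

/-- the tail `P(N ≥ j+1)` of the block-comb count, as an explicit finite sum -/
local notation3 "TAIL[" D ", " q ", " lv ", " a ", " g ", " j "]" =>
  ∑ i ∈ Finset.range ((D : ℕ) + 1), pd[D, q, i] *
    ∑ S : Finset κ, wt[g, S] * (if (j : ℕ) + 1 ≤ mass[lv, a, i, S] then (1 : ℝ) else 0)

omit [Fintype κ] [DecidableEq κ] in
/-- The root mass of a configuration as a real sum of the truncated sizes `a' k = a k·𝟙[lv k = 0]`. [folklore] -/
theorem mass_zero_cast (lv : κ → ℕ) (a : κ → ℕ) (S : Finset κ) :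
    ((mass[lv, a, 0, S] : ℕ) : ℝ) = ∑ k ∈ S, (if lv k = 0 then (a k : ℝ) else 0) := by
  push_cast
  rw [← Finset.sum_filter]
  refine Finset.sum_congr ?_ fun _ _ => rfl
  ext k
  simp only [Finset.mem_filter, Nat.le_zero]

/-- A configuration missing a gate-`1` blob has weight `0`. [folklore] -/
theorem wt_eq_zero_of_sure_notMem (g : κ → ℝ) (S : Finset κ) (k : κ) (hk : g k = 1) (hkS : k ∉ S) :
    wt[g, S] = 0 := by
  refine Finset.prod_eq_zero (Finset.mem_univ k) ?_
  rw [if_neg hkS, hk, sub_self]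

omit [DecidableEq κ] in
/-- With only levels `0` and `1`, the depth-`1` mass of a configuration containing every level-`1` blob is its root mass plus
the whole level-`1` mass. [folklore] -/
theorem mass_one_cast_of_all_mem (lv : κ → ℕ) (hlv : ∀ k, lv k ≤ 1) (a : κ → ℕ) (S : Finset κ)
    (hall : ∀ k, lv k ≠ 0 → k ∈ S) :
    ((mass[lv, a, 1, S] : ℕ) : ℝ) =
      ∑ k ∈ S, (if lv k = 0 then (a k : ℝ) else 0) + ∑ k, (if lv k = 0 then (0 : ℝ) else (a k : ℝ)) := by
  have hfilter : S.filter (fun k => lv k ≤ 1) = S := Finset.filter_true_of_mem fun k _ => hlv k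
  rw [hfilter]
  push_cast
  have hsplit : ∑ k ∈ S, (a k : ℝ) =
      ∑ k ∈ S, (if lv k = 0 then (a k : ℝ) else 0) + ∑ k ∈ S, (if lv k = 0 then (0 : ℝ) else (a k : ℝ)) := by
    rw [← Finset.sum_add_distrib]
    refine Finset.sum_congr rfl fun k _ => ?_
    split_ifs <;> ring
  rw [hsplit]
  congr 1
  -- level-`1` part: every level-`1` blob is in `S`, and the summand vanishes elsewhere
  refine Finset.sum_subset (Finset.subset_univ S) fun k _ hkS => ?_
  by_cases hk : lv k = 0
  · rw [if_pos hk]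
  · exact absurd (hall k hk) hkS

/-- **THE BLOCK-STAR ROW UNDER THE MEAN HYPOTHESIS (canonical `D = 1` bridge to `IndepBlob.far_indepBlob`).**  One chain gate `q 0 ∈ [0,1]`,
levels `≤ 1`, root blobs with private gates `g k ≥ q 0`, level-`1` blobs sure (`g k = 1`), all gates in `[0,1]`, and
`2j < Σ_{lv k = 0} a k·g k + q 0·Σ_{lv k ≠ 0} a k` (the mean of the count exceeds `2j`); then `q 0 ≤ TAIL[1, q, lv, a, g, j]`
(`P(N ≥ j+1)` is at least the least marginal `q 0`). [this work] -/
theorem tail_one_ge_rootGate_of_mean (q : ℕ → ℝ) (hq0 : 0 ≤ q 0 ∧ q 0 ≤ 1) (lv : κ → ℕ) (hlv : ∀ k, lv k ≤ 1)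
    (a : κ → ℕ) (g : κ → ℝ) (hg : ∀ k, 0 ≤ g k ∧ g k ≤ 1)
    (hgate : ∀ k, lv k = 0 → q 0 ≤ g k) (hsure : ∀ k, lv k ≠ 0 → g k = 1) (j : ℕ)
    (hmean : (2 * j : ℝ) < ∑ k ∈ Finset.univ.filter (fun k => lv k = 0), (a k : ℝ) * g k +
      q 0 * ∑ k ∈ Finset.univ.filter (fun k => lv k ≠ 0), (a k : ℝ)) :
    q 0 ≤ TAIL[1, q, lv, a, g, j] := by
  -- truncated sizes and the terminal block
  set a' : κ → ℝ := fun k => if lv k = 0 then (a k : ℝ) else 0 with ha'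
  set C : ℝ := ∑ k, (if lv k = 0 then (0 : ℝ) else (a k : ℝ)) with hC
  have ha'0 : ∀ k, 0 ≤ a' k := fun k => by by_cases hk : lv k = 0 <;> simp [ha', hk]
  have hC0 : 0 ≤ C := Finset.sum_nonneg fun k _ => by split_ifs <;> positivity
  have hp : ∀ k, q 0 ≤ g k := by
    intro k
    by_cases hk : lv k = 0
    · exact hgate k hk
    · rw [hsure k hk]; exact hq0.2
  -- the mean in `far_indepBlob`'s form
  have hmean' : (2 * (j : ℝ)) < C * q 0 + ∑ k, a' k * g k := by
    have h1 : ∑ k, a' k * g k = ∑ k ∈ Finset.univ.filter (fun k => lv k = 0), (a k : ℝ) * g k := by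
      rw [Finset.sum_filter]
      refine Finset.sum_congr rfl fun k _ => ?_
      by_cases hk : lv k = 0 <;> simp [ha', hk]
    have h2 : C = ∑ k ∈ Finset.univ.filter (fun k => lv k ≠ 0), (a k : ℝ) := by
      rw [hC, Finset.sum_filter]
      refine Finset.sum_congr rfl fun k _ => ?_
      by_cases hk : lv k = 0 <;> simp [hk]
    rw [h1, h2]
    linarith
  have hfar := IndepBlob.far_indepBlob g a' (q 0) C hq0.1 hq0.2 hp (fun k => (hg k).2) ha'0 hC0 (j : ℝ) hmean'
  -- light masses
  set L0 : ℝ := ∑ W ∈ (Finset.univ : Finset (Finset κ)).filter (fun W => ∑ i ∈ W, a' i ≤ (j : ℝ)), wt[g, W] with hL0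
  set L1 : ℝ := ∑ W ∈ (Finset.univ : Finset (Finset κ)).filter (fun W => ∑ i ∈ W, a' i + C ≤ (j : ℝ)), wt[g, W] with hL1
  have hfar' : q 0 * L1 + (1 - q 0) * L0 ≤ 1 - q 0 := hfar
  -- the two configuration sums of `TAIL[1, …]`
  have hX0 : ∑ S : Finset κ, wt[g, S] * (if j + 1 ≤ mass[lv, a, 0, S] then (1 : ℝ) else 0) = 1 - L0 := by
    have hL0' : L0 = ∑ S : Finset κ, (if ∑ i ∈ S, a' i ≤ (j : ℝ) then wt[g, S] else 0) := by
      rw [hL0, Finset.sum_filter]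
    rw [hL0', eq_sub_iff_add_eq, ← Finset.sum_add_distrib]
    refine (Finset.sum_congr rfl fun S _ => ?_).trans (IndepBlob.sum_bernoulliWeight g)
    have hcast := mass_zero_cast lv a S
    have ha'S : ∑ i ∈ S, a' i = ((mass[lv, a, 0, S] : ℕ) : ℝ) := by rw [hcast]
    by_cases hS : j + 1 ≤ mass[lv, a, 0, S]
    · have hnot : ¬ (∑ i ∈ S, a' i ≤ (j : ℝ)) := by
        rw [ha'S, not_le]; exact_mod_cast Nat.lt_of_succ_le hS
      rw [if_pos hS, if_neg hnot]; ring
    · have hyes : ∑ i ∈ S, a' i ≤ (j : ℝ) := by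
        rw [ha'S]; exact_mod_cast Nat.lt_succ_iff.1 (Nat.lt_of_not_le hS)
      rw [if_neg hS, if_pos hyes]; ring
  have hX1 : ∑ S : Finset κ, wt[g, S] * (if j + 1 ≤ mass[lv, a, 1, S] then (1 : ℝ) else 0) = 1 - L1 := by
    have hL1' : L1 = ∑ S : Finset κ, (if ∑ i ∈ S, a' i + C ≤ (j : ℝ) then wt[g, S] else 0) := by
      rw [hL1, Finset.sum_filter]
    rw [hL1', eq_sub_iff_add_eq, ← Finset.sum_add_distrib]
    refine (Finset.sum_congr rfl fun S _ => ?_).trans (IndepBlob.sum_bernoulliWeight g)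
    by_cases hall : ∀ k, lv k ≠ 0 → k ∈ S
    · have hcast := mass_one_cast_of_all_mem lv hlv a S hall
      have ha'S : ∑ i ∈ S, a' i + C = ((mass[lv, a, 1, S] : ℕ) : ℝ) := by rw [hcast]
      by_cases hS : j + 1 ≤ mass[lv, a, 1, S]
      · have hnot : ¬ (∑ i ∈ S, a' i + C ≤ (j : ℝ)) := by
          rw [ha'S, not_le]; exact_mod_cast Nat.lt_of_succ_le hS
        rw [if_pos hS, if_neg hnot]; ring
      · have hyes : ∑ i ∈ S, a' i + C ≤ (j : ℝ) := by
          rw [ha'S]; exact_mod_cast Nat.lt_succ_iff.1 (Nat.lt_of_not_le hS)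
        rw [if_neg hS, if_pos hyes]; ring
    · -- a sure level-`1` blob is missing: the configuration has weight `0`
      push Not at hall
      obtain ⟨k, hk, hkS⟩ := hall
      rw [wt_eq_zero_of_sure_notMem g S k (hsure k hk) hkS]
      split_ifs <;> simp
  -- assemble: `TAIL[1] = (1 − q 0)(1 − L0) + q 0 (1 − L1)`
  have hT : TAIL[1, q, lv, a, g, j] = (1 - q 0) * (1 - L0) + q 0 * (1 - L1) := by
    rw [Finset.sum_range_succ, Finset.sum_range_one, hX0, hX1]
    have hpd0 : pd[1, q, 0] = 1 - q 0 := by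
      show (∏ i' ∈ Finset.range 0, q i') * (if 0 < 1 then 1 - q 0 else 1) = 1 - q 0
      simp
    have hpd1 : pd[1, q, 1] = q 0 := by
      show (∏ i' ∈ Finset.range 1, q i') * (if 1 < 1 then 1 - q 1 else 1) = q 0
      simp
    rw [hpd0, hpd1]
  rw [hT]
  nlinarith [hfar', hq0.1, hq0.2]

end BlockComb

end Quant

end Summit.CriticalPhenomena.PercolationContinuityZ3.Theorems
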